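import Literature.AlgebraicGeometry.Resolution.QuadraticTransforms
import Mathlib.RingTheory.Derivation.Basic
import HarnessLib

/-!
# Crux `Steer` (stmt-ResolutionOfSingularities-16345), chain W4.1 — RUNG programme for hG3, brick B2:
# TELESCOPED LAW, DERIVATION GROWTH ALONG x-CHARTS, CONORMAL DETECTION

OURS (campaign `res-hironaka`, rung L ★L-G4, slot W4.1; seat res-L0-w41-stub-1 g4, res-L0-w41-plan-1 RULING 119e; blueprint
`L/res-L0-w41-stub-1/PERSIST-BLUEPRINT.md` 811204f015c0b400 §1 (L3′)/(L4)/(L5), §2 rows B2a/B2b/B4 (E1)). Statements about the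
route's own objects (the chain currency `S : ℕ → Subring L`, `f g : ∀ m, S m`, `x : ∀ m, S (m+1)`, the law
`f (m+1) · (x m)^d = f m − (g m)^p` of the G-words); they replace the role of no printed item and are NOT statements of the
manuscript under review [claim: Hironaka2017, status: under-review]; AI-produced, weaker than expert review. Theses-free,
definition-free, valuation-free, completion-free.

## Content

* §1 **Telescoped law** (`exists_telescope`): if `p ∣ d`, `d = p·e`, then for every `m` there are `G, W ∈ S m` with
  `f 0 = G^p + W^p · f m` and `W = ∏_{i<m} (x i)^e`; with persistence (`x i = uᵢ · x₀`, units `uᵢ`, res-type-062's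
  `PersistentChainValued.exists_unit_mul_eq_of_persistent`) `W = v · x₀^(m·e)` with `v` a unit of `S m`
  (`exists_telescope_of_persistent`). Hence ANY derivation of ANY characteristic-`p` ring through which the identity is read
  satisfies `D (f 0) = W^p · D (f m)` (`derivation_eq_of_telescope`: `p`-th powers are constants).
* §2 **Derivation growth along an x-chart** (`growth_step`, `growth_tower`): for a derivation `D` of a field `F`, a subring
  `𝒲 ≤ F` and a quadratic-transform-shaped step `R ≤ R₁ ≤ 𝒲` with chart element `t`, `t/x, x/t ∈ 𝒲`, if `x^m · D(R) ⊆ 𝒲` then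
  `x^(m+1) · D(R₁) ⊆ 𝒲` (quotient rule on `y/t` and on the fractions `a/b` of `IsQuadraticTransform`). Read through the order
  `ν = ord_x̄ ∘ π` of the completed arc (blueprint B5b, `𝒲 = {ν ≥ 0}`) this gives `ν(D (f 0)) ≥ m(d−1) → ∞`, i.e. every derivation of
  the completion kills `f 0` along the arc — tri-3 S6 (L3) WITHOUT coordinates.
* §3 **Conormal detection** (`mem_sq_of_forall_derivation_mem`, any commutative ring): if `P = (z₁,…,z_n)` carries dual
  derivations `D_i z_j = δ_ij`, then `u ∈ P` with all `D_i u ∈ P` lies in `P²` — the step «`f 0 − h^p ∈ Λ̂²`» of (L5).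

[cite: Matsumura1987, §25 p. 190] [folklore]
-/

noncomputable section

-- `Summit.<S>.<S>.…` duplicates the summit name by design (single-problem summit).
set_option linter.dupNamespace false
set_option autoImplicit false

namespace Summit.ResolutionOfSingularities.ResolutionOfSingularities.Theorems.SwitchingDichotomy.PersistentArc

open IsLocalRing
open Literature.AlgebraicGeometry.Resolution

/-! ## §1 The telescoped law -/

section Telescope

variable {L : Type} [Field L] (p : ℕ) [Fact p.Prime] [CharP L p]

/-- **Telescoped law.** From `f (m+1) · (x m)^(p·e) = f m − (g m)^p` for all `m`:
`f 0 = G^p + W^p · f m` with `G, W ∈ S m` and `W = ∏_{i<m} (x i)^e`. [folklore] -/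
theorem exists_telescope (S : ℕ → Subring L) (hle : ∀ m, S m ≤ S (m + 1)) (f g : ∀ m, S m) (x : ∀ m, S (m + 1))
    (e : ℕ)
    (hlaw : ∀ m, ((f (m + 1) : S (m + 1)) : L) * ((x m : S (m + 1)) : L) ^ (p * e)
      = ((f m : S m) : L) - ((g m : S m) : L) ^ p)
    (m : ℕ) : ∃ G W : L, G ∈ S m ∧ W ∈ S m ∧
      ((f 0 : S 0) : L) = G ^ p + W ^ p * ((f m : S m) : L) ∧
      W = ∏ i ∈ Finset.range m, ((x i : S (i + 1)) : L) ^ e := by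
  have hmono : Monotone S := monotone_nat_of_le_succ hle
  have hp0 : p ≠ 0 := (Fact.out : p.Prime).ne_zero
  induction m with
  | zero =>
    refine ⟨0, 1, (S 0).zero_mem, (S 0).one_mem, ?_, by simp⟩
    rw [zero_pow hp0, one_pow, zero_add, one_mul]
  | succ m ih =>
    obtain ⟨G, W, hG, hW, hf, hWprod⟩ := ih
    refine ⟨G + W * ((g m : S m) : L), W * ((x m : S (m + 1)) : L) ^ e,
      hle m ((S m).add_mem hG ((S m).mul_mem hW (g m).2)),
      (S (m + 1)).mul_mem (hle m hW) ((S (m + 1)).pow_mem (x m).2 e), ?_, ?_⟩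
    · -- `f m = (g m)^p + ((x m)^e)^p · f (m+1)`
      have hfm : ((f m : S m) : L) = ((g m : S m) : L) ^ p
          + (((x m : S (m + 1)) : L) ^ e) ^ p * ((f (m + 1) : S (m + 1)) : L) := by
        have h := hlaw m
        rw [pow_mul'] at h
        linear_combination -h
      rw [hf, hfm, add_pow_char, mul_pow, mul_pow]
      ring
    · rw [hWprod, Finset.prod_range_succ]

/-- **Telescoped law under persistence.** If moreover every `x i` is `uᵢ · x₀` with `uᵢ` a unit of `S (i+1)` (the output
of res-type-062's `PersistentChainValued.exists_unit_mul_eq_of_persistent`), then `W = v · x₀^(m·e)` with `v · w = 1`,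
`v, w ∈ S m` (for `m ≥ 1`; at `m = 0`, `W = 1`). [folklore] -/
theorem exists_telescope_of_persistent (S : ℕ → Subring L) (hle : ∀ m, S m ≤ S (m + 1)) (f g : ∀ m, S m)
    (x : ∀ m, S (m + 1)) (e : ℕ)
    (hlaw : ∀ m, ((f (m + 1) : S (m + 1)) : L) * ((x m : S (m + 1)) : L) ^ (p * e)
      = ((f m : S m) : L) - ((g m : S m) : L) ^ p)
    (x₀ : L)
    (hux : ∀ i, ∃ u w : L, u ∈ S (i + 1) ∧ w ∈ S (i + 1) ∧ u * w = 1 ∧ ((x i : S (i + 1)) : L) = u * x₀)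
    (m : ℕ) : ∃ G W v w : L, G ∈ S m ∧ W ∈ S m ∧ v ∈ S m ∧ w ∈ S m ∧ v * w = 1 ∧
      ((f 0 : S 0) : L) = G ^ p + W ^ p * ((f m : S m) : L) ∧ W = v * x₀ ^ (m * e) := by
  have hmono : Monotone S := monotone_nat_of_le_succ hle
  obtain ⟨G, W, hG, hW, hf, hWprod⟩ := exists_telescope p S hle f g x e hlaw m
  -- the unit: `∏_{i<m} uᵢ^e`
  have key : ∀ n ≤ m, ∃ v w : L, v ∈ S n ∧ w ∈ S n ∧ v * w = 1 ∧
      (∏ i ∈ Finset.range n, ((x i : S (i + 1)) : L) ^ e) = v * x₀ ^ (n * e) := by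
    intro n hn
    induction n with
    | zero => exact ⟨1, 1, (S 0).one_mem, (S 0).one_mem, one_mul 1, by simp⟩
    | succ n ih =>
      obtain ⟨v, w, hv, hw, hvw, hprod⟩ := ih (Nat.le_of_succ_le hn)
      obtain ⟨u, u', hu, hu', huu', hxn⟩ := hux n
      refine ⟨v * u ^ e, w * u' ^ e, (S (n + 1)).mul_mem (hle n hv) ((S (n + 1)).pow_mem hu e),
        (S (n + 1)).mul_mem (hle n hw) ((S (n + 1)).pow_mem hu' e), ?_, ?_⟩
      · calc v * u ^ e * (w * u' ^ e) = (v * w) * (u * u') ^ e := by ring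
          _ = 1 := by rw [hvw, huu', one_pow, one_mul]
      · rw [Finset.prod_range_succ, hprod, hxn, Nat.succ_mul, pow_add, mul_pow]; ring
  obtain ⟨v, w, hv, hw, hvw, hprod⟩ := key m le_rfl
  exact ⟨G, W, v, w, hG, hW, hv, hw, hvw, hf, by rw [hWprod, hprod]⟩

end Telescope

/-- **`p`-th powers are constants**: any derivation of a ring of characteristic `p` reading the telescoped identity
`f₀ = G^p + W^p · f` gives `D f₀ = W^p · D f`. [cite: Matsumura1987, §25 p. 190] -/
theorem derivation_eq_of_telescope {A : Type} [CommRing A] (p : ℕ) [Fact p.Prime] [CharP A p]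
    (D : Derivation ℤ A A) {f₀ G W f : A} (h : f₀ = G ^ p + W ^ p * f) : D f₀ = W ^ p * D f := by
  have hkill : ∀ a : A, D (a ^ p) = 0 := fun a => by
    rw [D.leibniz_pow, ← Nat.cast_smul_eq_nsmul A p, CharP.cast_eq_zero A p, zero_smul]
  rw [h, map_add, hkill, zero_add, D.leibniz, hkill, smul_zero, add_zero, smul_eq_mul]

/-! ## §2 Derivation growth along an x-chart -/

section Growth

variable {F : Type} [Field F]

/-- **Growth on the blow-up ring.** `D` a derivation of the field `F`, `𝒲 ≤ F` a subring, `R ≤ 𝒲` a local subring with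
`x^m · D(R) ⊆ 𝒲`, and a chart element `t ∈ R`, `t ≠ 0`, with `t/x, x/t ∈ 𝒲` and `R[𝔪_R/t] ≤ 𝒲`: then
`x^(m+1) · D(R[𝔪_R/t]) ⊆ 𝒲`. [folklore] -/
theorem growth_blowupRing (D : Derivation ℤ F F) (𝒲 R : Subring F) [IsLocalRing R] {x t : F} (ht0 : t ≠ 0)
    (htR : t ∈ R) (hxt : x / t ∈ 𝒲) (hbl : blowupRing R t ≤ 𝒲) {m : ℕ} (hD : ∀ r ∈ R, x ^ m * D r ∈ 𝒲) :
    ∀ z ∈ blowupRing R t, x ^ (m + 1) * D z ∈ 𝒲 := by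
  have hRbl : R ≤ blowupRing R t := fun r hr => Subring.subset_closure (Or.inl hr)
  intro z hz
  -- closure induction with the predicate `z ∈ 𝒲 ∧ x^(m+1) · D z ∈ 𝒲`
  suffices h : z ∈ 𝒲 ∧ x ^ (m + 1) * D z ∈ 𝒲 from h.2
  induction hz using Subring.closure_induction with
  | mem z hz =>
    rcases hz with hz | ⟨y, hy, rfl⟩
    · refine ⟨hbl (hRbl hz), ?_⟩
      rw [pow_succ, mul_assoc, mul_comm x, ← mul_assoc]
      exact 𝒲.mul_mem (hD z hz) (by
        have : x = x / t * t := by rw [div_mul_cancel₀ x ht0]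
        rw [this]; exact 𝒲.mul_mem hxt (hbl (hRbl htR)))
    · refine ⟨hbl (div_mem_blowupRing t hy), ?_⟩
      -- `x^(m+1) D(y/t) = (x^m D y)(x/t) - (y/t)(x^m D t)(x/t)`
      have hyt : ((y : R) : F) / t ∈ 𝒲 := hbl (div_mem_blowupRing t hy)
      have e1 : x ^ (m + 1) * D (((y : R) : F) / t)
          = (x ^ m * D ((y : R) : F)) * (x / t) - ((y : R) : F) / t * (x ^ m * D t) * (x / t) := by
        rw [D.leibniz_div, smul_eq_mul]
        field_simp
        ring
      rw [e1]
      exact 𝒲.sub_mem (𝒲.mul_mem (hD _ y.2) hxt) (𝒲.mul_mem (𝒲.mul_mem hyt (hD t htR)) hxt)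
  | zero => exact ⟨𝒲.zero_mem, by rw [map_zero, mul_zero]; exact 𝒲.zero_mem⟩
  | one => exact ⟨𝒲.one_mem, by rw [D.map_one_eq_zero, mul_zero]; exact 𝒲.zero_mem⟩
  | add a b _ _ ha hb =>
    exact ⟨𝒲.add_mem ha.1 hb.1, by rw [map_add, mul_add]; exact 𝒲.add_mem ha.2 hb.2⟩
  | neg a _ ha => exact ⟨𝒲.neg_mem ha.1, by rw [map_neg, mul_neg]; exact 𝒲.neg_mem ha.2⟩
  | mul a b _ _ ha hb =>
    refine ⟨𝒲.mul_mem ha.1 hb.1, ?_⟩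
    rw [D.leibniz, smul_eq_mul, smul_eq_mul, mul_add, ← mul_assoc, mul_comm (x ^ (m + 1)) a, mul_assoc,
      ← mul_assoc (x ^ (m + 1)) b, mul_comm (x ^ (m + 1)) b, mul_assoc b]
    exact 𝒲.add_mem (𝒲.mul_mem ha.1 hb.2) (𝒲.mul_mem hb.1 ha.2)

/-- **Growth step along an x-chart.** As in `growth_blowupRing`, plus the fraction clause of `IsQuadraticTransform`:
every `z ∈ R₁` is `a/b` with `a, b ∈ R[𝔪_R/t]` and `b⁻¹ ∈ R₁`; if `R₁ ≤ 𝒲` then `x^(m+1) · D(R₁) ⊆ 𝒲`. [folklore] -/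
theorem growth_step (D : Derivation ℤ F F) (𝒲 R R₁ : Subring F) [IsLocalRing R] {x t : F} (ht0 : t ≠ 0)
    (htR : t ∈ R) (hxt : x / t ∈ 𝒲) (hbl : blowupRing R t ≤ R₁) (hR₁ : R₁ ≤ 𝒲)
    (hfrac : ∀ z ∈ R₁, ∃ a ∈ blowupRing R t, ∃ b ∈ blowupRing R t, b⁻¹ ∈ R₁ ∧ z = a / b)
    {m : ℕ} (hD : ∀ r ∈ R, x ^ m * D r ∈ 𝒲) : ∀ z ∈ R₁, x ^ (m + 1) * D z ∈ 𝒲 := by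
  have hgrow := growth_blowupRing D 𝒲 R ht0 htR hxt (hbl.trans hR₁) hD
  intro z hz
  obtain ⟨a, ha, b, hb, hbinv, rfl⟩ := hfrac z hz
  by_cases hb0 : b = 0
  · rw [hb0, div_zero, map_zero, mul_zero]; exact 𝒲.zero_mem
  -- `x^(m+1) D(a/b) = b⁻¹ (x^(m+1) D a) - (a/b) b⁻¹ (x^(m+1) D b)`
  have e1 : x ^ (m + 1) * D (a / b) = b⁻¹ * (x ^ (m + 1) * D a) - a / b * b⁻¹ * (x ^ (m + 1) * D b) := by
    rw [D.leibniz_div, smul_eq_mul]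
    field_simp
    ring
  rw [e1]
  exact 𝒲.sub_mem (𝒲.mul_mem (hR₁ hbinv) (hgrow a ha))
    (𝒲.mul_mem (𝒲.mul_mem (hR₁ hz) (hR₁ hbinv)) (hgrow b hb))

/-- **Growth along the tower.** A chain `S 0 ≤ S 1 ≤ ⋯ ≤ 𝒲` of local subrings of `F` with quadratic-transform-shaped
steps whose chart elements `t m` satisfy `t m / x, x / t m ∈ 𝒲` (all steps are x-charts): if `D(S 0) ⊆ 𝒲` then
`x^m · D(S m) ⊆ 𝒲` for every `m`. [folklore] -/
theorem growth_tower (D : Derivation ℤ F F) (𝒲 : Subring F) (S : ℕ → Subring F) [∀ m, IsLocalRing (S m)]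
    (hSW : ∀ m, S m ≤ 𝒲) {x : F} (t : ℕ → F) (ht0 : ∀ m, t m ≠ 0) (htS : ∀ m, t m ∈ S m)
    (hxt : ∀ m, x / t m ∈ 𝒲) (hbl : ∀ m, blowupRing (S m) (t m) ≤ S (m + 1))
    (hfrac : ∀ m, ∀ z ∈ S (m + 1), ∃ a ∈ blowupRing (S m) (t m), ∃ b ∈ blowupRing (S m) (t m),
      b⁻¹ ∈ S (m + 1) ∧ z = a / b)
    (hD : ∀ r ∈ S 0, D r ∈ 𝒲) : ∀ m, ∀ z ∈ S m, x ^ m * D z ∈ 𝒲 := by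
  intro m
  induction m with
  | zero => intro z hz; rw [pow_zero, one_mul]; exact hD z hz
  | succ m ih => exact growth_step D 𝒲 (S m) (S (m + 1)) (ht0 m) (htS m) (hxt m) (hbl m) (hSW (m + 1)) (hfrac m) ih

end Growth

/-! ## §3 Conormal detection -/

/-- **Conormal detection.** In any commutative ring, if `P = (z₁, …, z_n)` carries derivations `D_i` with `D_i z_j = δ_ij`,
then an element `u ∈ P` all of whose derivatives `D_i u` lie in `P` lies in `P²` (write `u = Σ a_j z_j`; then
`D_i u ≡ a_i (mod P)`). [folklore] -/
theorem mem_sq_of_forall_derivation_mem {A : Type} [CommRing A] {n : ℕ} (z : Fin n → A)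
    (D : Fin n → Derivation ℤ A A) (hD : ∀ i j, D i (z j) = if i = j then 1 else 0) {u : A}
    (hu : u ∈ Ideal.span (Set.range z)) (hDu : ∀ i, D i u ∈ Ideal.span (Set.range z)) :
    u ∈ Ideal.span (Set.range z) ^ 2 := by
  classical
  obtain ⟨a, rfl⟩ := Ideal.mem_span_range_iff_exists_fun.mp hu
  -- `D_i (Σ a_j z_j) = Σ (D_i a_j) z_j + a_i`
  have hai : ∀ i, a i ∈ Ideal.span (Set.range z) := by
    intro i
    have h1 : D i (∑ j, a j * z j) = (∑ j, D i (a j) * z j) + a i := by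
      rw [map_sum]
      have hj : ∀ j, D i (a j * z j) = D i (a j) * z j + (if i = j then a j else 0) := by
        intro j
        rw [Derivation.leibniz, smul_eq_mul, smul_eq_mul, hD]
        split_ifs <;> ring
      simp_rw [hj, Finset.sum_add_distrib, Finset.sum_ite_eq, Finset.mem_univ, if_true]
    have h2 : (∑ j, D i (a j) * z j) ∈ Ideal.span (Set.range z) :=
      Ideal.sum_mem _ fun j _ => Ideal.mul_mem_left _ _ (Ideal.subset_span ⟨j, rfl⟩)
    have := Ideal.sub_mem _ (hDu i) h2
    rwa [h1, add_sub_cancel_left] at this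
  rw [pow_two]
  exact Ideal.sum_mem _ fun j _ => Ideal.mul_mem_mul (hai j) (Ideal.subset_span ⟨j, rfl⟩)

end Summit.ResolutionOfSingularities.ResolutionOfSingularities.Theorems.SwitchingDichotomy.PersistentArc

end
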